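import Summits.NavierStokesRegularity.NavierStokesRegularity.Theorems.ScenarioCensusRowF1Pincer
import HarnessLib

/-!
# LINE 25 «eulerian-pincer» port, part 2/4: §6 THE KILL — the EULERIAN CLOCK of the enstrophy density in `𝒦` (pointwise ODE comparison with the stretching-certificate weight;
# `eq_zero_of_ebbing`, `eq_zero_of_flaring`, slices of the read-outs)

Re-homed for the scenario census (typer seat ns-census-typer-1 g9; the cells F1ie / F1if and the floors DE / DF are MEMBERS OF RECORD «DECIDED IN KERNEL IN FILES» of row F1
since census v1.77 (critic backstop idea-crit-7 PASS 03:14Z; ref ns-census-ref g10 PRE-CHECK ✓ §15.17 item 41; lead-presearch label); this port makes them TREE-decided):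
VERBATIM PORT of the NEW declarations (§1 read-outs, §6 kill, §8 rows) of ns-idea-3 LINE 25 «eulerian-pincer»,
`pub/ideators/ns-idea-3/lines/eulerian-pincer/line-eulerian-pincer.lean` sha16 b2a1952cbeded9c7 (1972 l., lean check rc 0, 0 sorry; the frame of §1, §2–§5 and §7 are
shared VERBATIM with LINES 18/20/22/24/27 and taken BY NAME from the landed ports — not re-declared), split for the 400-line rule into `ScenarioCensusRowF1Pincer` (§1
read-outs) → `…PincerKill` (§6) → `…PincerRows` (§8 numbers/rows) → `…PincerTop` (§8 verdicts + census KEYS).  Lean text VERBATIM in namespace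
`…Theorems.ScenarioCensus.EulerianPincer` (the line's `…Cruxes.ScenarioCensusRowF1.EulerianPincerLine` re-homed), shared names spelled by namespace (`LiouvilleSocket.…`
frame / τ-tool, `FrozenTop.…`, `InviscidTop.…`, `IntegratedStretch.…`, …); port edits: the bracket lines `section …` / `end …` dropped (no `variable`s), `@[conjecture]`
on the residual `PincerSlack` (≡ `ScenarioCensus.Row_F1`, OPEN), one-line docstrings added where missing (gate lint).  Statements untouched.

No census VALUE is moved here (row F1 stays OPEN-WITH-LINE; the members become TREE-decided by name); NS regularity is NOT proved; `Row_F1` is untouched (zero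
movement, `pincerSlack_iff_rowF1`); no summit statement is proved by this file.
-/

-- the summit and its single problem share the name `NavierStokesRegularity` (D-0017 nested layout)
set_option linter.dupNamespace false

noncomputable section

open MeasureTheory Set Function Filter TopologicalSpace Metric
open scoped Topology NNReal ENNReal InnerProductSpace RealInnerProductSpace Laplacian

namespace Summit.NavierStokesRegularity.NavierStokesRegularity.Theorems.ScenarioCensus.EulerianPincer

open Literature.Analysis Literature.Analysis.FluidPDE
open Summit.NavierStokesRegularity.NavierStokesRegularity.Theorems

/-! ## §6 THE KILL (NEW): the EULERIAN CLOCK of the enstrophy density in `𝒦` — a pointwise ODE comparison with the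
self-similar weight `(−s)^p`, BORN FROM ZERO at `s = −∞` when `p < 2` and DYING at `s = 0⁻` when `p > 2`

For `W ∈ 𝒦_C` and a point `y`, the vorticity `s ↦ ω̃(s, y) = curl W(s)(y)` is differentiable on the open past with
derivative `Δω̃ − (W·∇)ω̃ + (ω̃·∇)W` (the class is classical on windows).  If `⟪ω̃, ∂ₛω̃⟫ ≤ θ|ω̃|²/(−s)` with `θ < 1`
(resp. `≥ κ|ω̃|²/(−s)` with `κ > 1`) at every point, then `g(s) = (−s)^{2θ}|ω̃(s,y)|²` is non-increasing (resp.
`(−s)^{2κ}|ω̃|²` non-decreasing) on `(−∞, 0)`; the class-uniform scaling-sharp bound `(−s)|ω̃(s, y)| ≤ K`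
(`exists_gauge_norm_fderiv_le_of_typeI`, `|curl| ≤ ‖curl‖ |∇·|`) makes `g ≤ K²(−s)^{2θ−2} → 0` at `−∞`
(resp. `≤ K²(−s)^{2κ−2} → 0` at `0⁻`), so `g ≡ 0`: `ω̃ ≡ 0`, the slices are constant
(`eq_of_curl_eq_zero_of_isDivFree_of_bounded`) and the gauge kills constants (`IsTypeIAncientMild.eq_zero_of_slice_const`).
No maximum principle, no cut-off, no integration: the weight `(−s)^{2θ}` is the tree's stretching-certificate weight
(`stretchCert_curl_eq_zero`, `γ = 2 − 2δ`), but an EULERIAN hypothesis controls the full time derivative at each point,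
so the comparison is an ODE on every vertical line `{y} × (−∞, 0)` — and it runs in BOTH time directions. -/

/-- **Class-uniform scaling-sharp vorticity bound in `𝒦_C`**: `(−s) ‖curl W(s)(y)‖ ≤ K` for ONE `K = K(C) ≥ 0`. -/
theorem exists_neg_mul_norm_curl_le (C : ℝ) :
    ∃ K : ℝ, 0 ≤ K ∧ ∀ ⦃W : ℝ → LiouvilleSocket.E3 → LiouvilleSocket.E3⦄, IsTypeIAncientMild C W → ∀ s < (0 : ℝ), ∀ y : LiouvilleSocket.E3,
      (-s) * ‖curl (W s) y‖ ≤ K := by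
  obtain ⟨K₀, hK₀⟩ := exists_gauge_norm_fderiv_le_of_typeI C
  refine ⟨max (‖curlCLM‖ * K₀) 0, le_max_right _ _, fun W hW s hs y => ?_⟩
  have hs0 : 0 < -s := neg_pos.2 hs
  calc (-s) * ‖curl (W s) y‖ ≤ (-s) * (‖curlCLM‖ * ‖fderiv ℝ (W s) y‖) :=
        mul_le_mul_of_nonneg_left (norm_curl_le (W s) y) hs0.le
    _ = ‖curlCLM‖ * ((-s) * ‖fderiv ℝ (W s) y‖) := by ring
    _ ≤ ‖curlCLM‖ * K₀ := mul_le_mul_of_nonneg_left (hK₀ hW s hs y) (norm_nonneg curlCLM)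
    _ ≤ max (‖curlCLM‖ * K₀) 0 := le_max_left _ _

/-- The `s`-derivative of the weighted enstrophy density `(−s)^p |ω̃(s, y)|²` on the open past:
`−p(−s)^{p−1}|ω̃|² + (−s)^p · 2⟪ω̃, ∂ₛω̃⟫`. -/
theorem hasDerivAt_weightedEnstrophy {C : ℝ} {W : ℝ → LiouvilleSocket.E3 → LiouvilleSocket.E3} (hW : IsTypeIAncientMild C W) (p : ℝ) {s : ℝ}
    (hs : s < 0) (y : LiouvilleSocket.E3) :
    HasDerivAt (fun σ : ℝ => (-σ) ^ p * ‖curl (W σ) y‖ ^ 2)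
      (-(p * (-s) ^ (p - 1)) * ‖curl (W s) y‖ ^ 2 + (-s) ^ p * (2 * ⟪curl (W s) y, IntegratedQuench.vdot W s y⟫)) s := by
  have hneg : HasDerivAt (fun σ : ℝ => -σ) (-1 : ℝ) s := hasDerivAt_neg' s
  have h1 : HasDerivAt (fun σ : ℝ => (-σ) ^ p) (-(p * (-s) ^ (p - 1))) s := by
    have h := hneg.rpow_const (p := p) (Or.inl (neg_pos.2 hs).ne')
    convert h using 1
    ring
  have h2 : HasDerivAt (fun σ : ℝ => ‖curl (W σ) y‖ ^ 2) (2 * ⟪curl (W s) y, IntegratedQuench.vdot W s y⟫) s :=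
    (IntegratedQuench.hasDerivAt_curl hW hs y).norm_sq
  exact h1.mul h2

/-- The pointwise bound `(−s)^p |ω̃(s,y)|² ≤ K² (−s)^{p−2}` from the scaling-sharp vorticity bound. -/
theorem weightedEnstrophy_le {C K p : ℝ} {W : ℝ → LiouvilleSocket.E3 → LiouvilleSocket.E3} (hW : IsTypeIAncientMild C W)
    (hK : ∀ s < (0 : ℝ), ∀ y : LiouvilleSocket.E3, (-s) * ‖curl (W s) y‖ ≤ K) {s : ℝ} (hs : s < 0) (y : LiouvilleSocket.E3) :
    (-s) ^ p * ‖curl (W s) y‖ ^ 2 ≤ K ^ 2 * (-s) ^ (p - 2) := by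
  have _ := hW.nonneg
  have hs0 : 0 < -s := neg_pos.2 hs
  have hK0 : 0 ≤ K := le_trans (mul_nonneg hs0.le (norm_nonneg _)) (hK s hs y)
  have h1 : ‖curl (W s) y‖ ≤ K / (-s) := by
    rw [le_div_iff₀ hs0, mul_comm]
    exact hK s hs y
  have h2 : ‖curl (W s) y‖ ^ 2 ≤ (K / (-s)) ^ 2 := pow_le_pow_left₀ (norm_nonneg _) h1 2
  calc (-s) ^ p * ‖curl (W s) y‖ ^ 2 ≤ (-s) ^ p * (K / (-s)) ^ 2 :=
        mul_le_mul_of_nonneg_left h2 (Real.rpow_nonneg hs0.le p)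
    _ = K ^ 2 * (-s) ^ (p - 2) := by
        rw [Real.rpow_sub hs0, Real.rpow_two, div_pow]
        field_simp

/-- **Born from zero at `−∞`**: if `(−s)^p |ω̃(s, y)|²` is non-increasing on the open past and `p < 2`, then
`ω̃(·, y) ≡ 0`. -/
theorem curl_eq_zero_of_antitoneOn {C p : ℝ} (hp : p < 2) {W : ℝ → LiouvilleSocket.E3 → LiouvilleSocket.E3} (hW : IsTypeIAncientMild C W) (y : LiouvilleSocket.E3)
    (hanti : AntitoneOn (fun σ : ℝ => (-σ) ^ p * ‖curl (W σ) y‖ ^ 2) (Iio 0)) :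
    ∀ s < (0 : ℝ), curl (W s) y = 0 := by
  obtain ⟨K, _, hK⟩ := exists_neg_mul_norm_curl_le C
  intro s₀ hs₀
  have hlim0 : Tendsto (fun σ : ℝ => (-σ) ^ (p - 2)) atBot (𝓝 0) := by
    have h := (tendsto_rpow_neg_atTop (by linarith : 0 < 2 - p)).comp tendsto_neg_atBot_atTop
    refine h.congr' (Eventually.of_forall fun σ => ?_)
    simp only [Function.comp_apply]
    congr 1
    ring
  have hlim : Tendsto (fun σ : ℝ => K ^ 2 * (-σ) ^ (p - 2)) atBot (𝓝 0) := by
    simpa using hlim0.const_mul (K ^ 2)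
  have hle : (-s₀) ^ p * ‖curl (W s₀) y‖ ^ 2 ≤ 0 := by
    refine ge_of_tendsto hlim ?_
    filter_upwards [eventually_le_atBot s₀] with σ hσ
    have hσ0 : σ < 0 := lt_of_le_of_lt hσ hs₀
    exact (hanti (show σ ∈ Iio (0 : ℝ) from hσ0) (show s₀ ∈ Iio (0 : ℝ) from hs₀) hσ).trans
      (weightedEnstrophy_le hW (hK hW) hσ0 y)
  have hpow : 0 < (-s₀) ^ p := Real.rpow_pos_of_pos (neg_pos.2 hs₀) p
  have hsq : ‖curl (W s₀) y‖ ^ 2 ≤ 0 := by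
    by_contra hcon
    exact absurd hle (not_le.2 (mul_pos hpow (lt_of_not_ge hcon)))
  exact norm_eq_zero.1 (le_antisymm (by nlinarith [norm_nonneg (curl (W s₀) y)]) (norm_nonneg _))

/-- **Dying at `0⁻`**: if `(−s)^p |ω̃(s, y)|²` is non-decreasing on the open past and `p > 2`, then `ω̃(·, y) ≡ 0`. -/
theorem curl_eq_zero_of_monotoneOn {C p : ℝ} (hp : 2 < p) {W : ℝ → LiouvilleSocket.E3 → LiouvilleSocket.E3} (hW : IsTypeIAncientMild C W) (y : LiouvilleSocket.E3)
    (hmono : MonotoneOn (fun σ : ℝ => (-σ) ^ p * ‖curl (W σ) y‖ ^ 2) (Iio 0)) :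
    ∀ s < (0 : ℝ), curl (W s) y = 0 := by
  obtain ⟨K, _, hK⟩ := exists_neg_mul_norm_curl_le C
  intro s₀ hs₀
  have hlim0 : Tendsto (fun σ : ℝ => (-σ) ^ (p - 2)) (𝓝[<] (0 : ℝ)) (𝓝 0) := by
    have hc : ContinuousAt (fun x : ℝ => x ^ (p - 2)) 0 :=
      Real.continuousAt_rpow_const 0 (p - 2) (Or.inr (by linarith))
    have h0 : (0 : ℝ) ^ (p - 2) = 0 := Real.zero_rpow (by linarith : p - 2 ≠ 0)
    have h1 : Tendsto (fun x : ℝ => x ^ (p - 2)) (𝓝 0) (𝓝 0) := by simpa [h0] using hc.tendsto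
    have h2 : Tendsto (fun σ : ℝ => -σ) (𝓝[<] (0 : ℝ)) (𝓝 0) := by
      have h := (continuous_neg.tendsto (0 : ℝ)).mono_left (nhdsWithin_le_nhds (s := Iio (0 : ℝ)))
      simpa using h
    exact h1.comp h2
  have hlim : Tendsto (fun σ : ℝ => K ^ 2 * (-σ) ^ (p - 2)) (𝓝[<] (0 : ℝ)) (𝓝 0) := by
    simpa using hlim0.const_mul (K ^ 2)
  have hle : (-s₀) ^ p * ‖curl (W s₀) y‖ ^ 2 ≤ 0 := by
    refine ge_of_tendsto hlim ?_
    filter_upwards [Ioo_mem_nhdsLT hs₀] with σ hσ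
    exact (hmono (show s₀ ∈ Iio (0 : ℝ) from hs₀) (show σ ∈ Iio (0 : ℝ) from hσ.2) hσ.1.le).trans
      (weightedEnstrophy_le hW (hK hW) hσ.2 y)
  have hpow : 0 < (-s₀) ^ p := Real.rpow_pos_of_pos (neg_pos.2 hs₀) p
  have hsq : ‖curl (W s₀) y‖ ^ 2 ≤ 0 := by
    by_contra hcon
    exact absurd hle (not_le.2 (mul_pos hpow (lt_of_not_ge hcon)))
  exact norm_eq_zero.1 (le_antisymm (by nlinarith [norm_nonneg (curl (W s₀) y)]) (norm_nonneg _))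

/-- From vanishing vorticity on the open past to `W ≡ 0` in `𝒦`: bounded div-free curl-free slices are constant and
the gauge kills constants. -/
theorem eq_zero_of_curl_eq_zero {C : ℝ} {W : ℝ → LiouvilleSocket.E3 → LiouvilleSocket.E3} (hW : IsTypeIAncientMild C W)
    (hω : ∀ s < (0 : ℝ), ∀ y : LiouvilleSocket.E3, curl (W s) y = 0) : ∀ s < (0 : ℝ), ∀ y : LiouvilleSocket.E3, W s y = 0 := by
  have hub : ∀ s < (0 : ℝ), ∀ y : LiouvilleSocket.E3, W s y = W s 0 := fun s hs y =>
    eq_of_curl_eq_zero_of_isDivFree_of_bounded ((hW.contDiff_slice hs).of_le (by norm_cast))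
      (hω s hs) (hW.isDivFree hs) (fun z => hW.norm_le hs z) y 0
  exact fun s hs y => hW.eq_zero_of_slice_const hub hs y

/-- **THE KILL, sub-self-similar side: an EULERIAN-EBBING `𝒦` is trivial.**  `W ∈ 𝒦_C` with
`⟪ω̃, ∂ₛω̃⟫ ≤ θ |ω̃|²/(−s)` at every point of the open past (`∂ₛω̃ = Δω̃ − (W·∇)ω̃ + (ω̃·∇)W`), `θ < 1`, vanishes. -/
theorem eq_zero_of_ebbing {C θ : ℝ} (hθ : θ < 1) {W : ℝ → LiouvilleSocket.E3 → LiouvilleSocket.E3} (hW : IsTypeIAncientMild C W)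
    (h : ∀ s < (0 : ℝ), ∀ y : LiouvilleSocket.E3, ⟪curl (W s) y, IntegratedQuench.vdot W s y⟫ ≤ θ * ((-s)⁻¹ * ‖curl (W s) y‖ ^ 2)) :
    ∀ s < (0 : ℝ), ∀ y : LiouvilleSocket.E3, W s y = 0 := by
  refine eq_zero_of_curl_eq_zero hW fun s hs y => ?_
  refine curl_eq_zero_of_antitoneOn (p := 2 * θ) (by linarith) hW y ?_ s hs
  have hint : interior (Iio (0 : ℝ)) = Iio 0 := interior_Iio
  refine antitoneOn_of_hasDerivWithinAt_nonpos (convex_Iio 0)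
    (f' := fun σ => -(2 * θ * (-σ) ^ (2 * θ - 1)) * ‖curl (W σ) y‖ ^ 2 +
      (-σ) ^ (2 * θ) * (2 * ⟪curl (W σ) y, IntegratedQuench.vdot W σ y⟫)) ?_ ?_ ?_
  · intro σ hσ
    exact (hasDerivAt_weightedEnstrophy hW (2 * θ) hσ y).continuousAt.continuousWithinAt
  · intro σ hσ
    rw [hint] at hσ ⊢
    exact (hasDerivAt_weightedEnstrophy hW (2 * θ) hσ y).hasDerivWithinAt
  · intro σ hσ
    rw [hint] at hσ
    have hσ' : σ < 0 := hσ
    have hσ0 : 0 < -σ := neg_pos.2 hσ'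
    have hA : 0 ≤ (-σ) ^ (2 * θ) := Real.rpow_nonneg hσ0.le _
    have e : (-σ) ^ (2 * θ - 1) = (-σ) ^ (2 * θ) * (-σ)⁻¹ := by
      rw [Real.rpow_sub_one hσ0.ne', div_eq_mul_inv]
    have hm := mul_le_mul_of_nonneg_left (h σ hσ' y) hA
    rw [e]
    nlinarith [hm]

/-- **THE KILL, super-self-similar side: an EULERIAN-FLARING `𝒦` is trivial.**  `W ∈ 𝒦_C` with
`κ |ω̃|²/(−s) ≤ ⟪ω̃, ∂ₛω̃⟫` at every point of the open past, `κ > 1`, vanishes. -/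
theorem eq_zero_of_flaring {C κ : ℝ} (hκ : 1 < κ) {W : ℝ → LiouvilleSocket.E3 → LiouvilleSocket.E3} (hW : IsTypeIAncientMild C W)
    (h : ∀ s < (0 : ℝ), ∀ y : LiouvilleSocket.E3, κ * ((-s)⁻¹ * ‖curl (W s) y‖ ^ 2) ≤ ⟪curl (W s) y, IntegratedQuench.vdot W s y⟫) :
    ∀ s < (0 : ℝ), ∀ y : LiouvilleSocket.E3, W s y = 0 := by
  refine eq_zero_of_curl_eq_zero hW fun s hs y => ?_
  refine curl_eq_zero_of_monotoneOn (p := 2 * κ) (by linarith) hW y ?_ s hs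
  have hint : interior (Iio (0 : ℝ)) = Iio 0 := interior_Iio
  refine monotoneOn_of_hasDerivWithinAt_nonneg (convex_Iio 0)
    (f' := fun σ => -(2 * κ * (-σ) ^ (2 * κ - 1)) * ‖curl (W σ) y‖ ^ 2 +
      (-σ) ^ (2 * κ) * (2 * ⟪curl (W σ) y, IntegratedQuench.vdot W σ y⟫)) ?_ ?_ ?_
  · intro σ hσ
    exact (hasDerivAt_weightedEnstrophy hW (2 * κ) hσ y).continuousAt.continuousWithinAt
  · intro σ hσ
    rw [hint] at hσ ⊢
    exact (hasDerivAt_weightedEnstrophy hW (2 * κ) hσ y).hasDerivWithinAt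
  · intro σ hσ
    rw [hint] at hσ
    have hσ' : σ < 0 := hσ
    have hσ0 : 0 < -σ := neg_pos.2 hσ'
    have hA : 0 ≤ (-σ) ^ (2 * κ) := Real.rpow_nonneg hσ0.le _
    have e : (-σ) ^ (2 * κ - 1) = (-σ) ^ (2 * κ) * (-σ)⁻¹ := by
      rw [Real.rpow_sub_one hσ0.ne', div_eq_mul_inv]
    have hm := mul_le_mul_of_nonneg_left (h σ hσ' y) hA
    rw [e]
    nlinarith [hm]

/-- `∂ₛω̃` is the read-out `FrozenTop.vortOf` of the slice data `(W, ∇W, ∇²W, Σᵢ D³W eᵢ eᵢ)(s, y)`. -/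
theorem vdot_eq_vortOf {C : ℝ} {W : ℝ → LiouvilleSocket.E3 → LiouvilleSocket.E3} (hW : IsTypeIAncientMild C W) {s : ℝ} (hs : s < 0) (y : LiouvilleSocket.E3) :
    IntegratedQuench.vdot W s y = FrozenTop.vortOf (W s y) (fderiv ℝ (W s) y) (fderiv ℝ (fderiv ℝ (W s)) y) (FrozenTop.lapD (W s) y) :=
  FrozenTop.transport_eq_vortOf ((hW.contDiff_slice hs).of_le (by norm_cast)) y

/-- The ebb read-out of the slice data at lag `τ` is `⟪ω̃, ∂ₛω̃⟫ − θ τ⁻¹ |ω̃|²`. -/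
theorem ebbOf_slice {C : ℝ} {W : ℝ → LiouvilleSocket.E3 → LiouvilleSocket.E3} (hW : IsTypeIAncientMild C W) (θ τ : ℝ) {s : ℝ} (hs : s < 0)
    (y : LiouvilleSocket.E3) :
    ebbOf θ τ (W s y) (fderiv ℝ (W s) y) (fderiv ℝ (fderiv ℝ (W s)) y) (FrozenTop.lapD (W s) y) =
      ⟪curl (W s) y, IntegratedQuench.vdot W s y⟫ - θ * (τ⁻¹ * ‖curl (W s) y‖ ^ 2) := by
  rw [ebbOf, ← vdot_eq_vortOf hW hs y]
  rfl

/-- The flare read-out of the slice data at lag `τ` is `κ τ⁻¹ |ω̃|² − ⟪ω̃, ∂ₛω̃⟫`. -/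
theorem flareOf_slice {C : ℝ} {W : ℝ → LiouvilleSocket.E3 → LiouvilleSocket.E3} (hW : IsTypeIAncientMild C W) (κ τ : ℝ) {s : ℝ} (hs : s < 0)
    (y : LiouvilleSocket.E3) :
    flareOf κ τ (W s y) (fderiv ℝ (W s) y) (fderiv ℝ (fderiv ℝ (W s)) y) (FrozenTop.lapD (W s) y) =
      κ * (τ⁻¹ * ‖curl (W s) y‖ ^ 2) - ⟪curl (W s) y, IntegratedQuench.vdot W s y⟫ := by
  rw [flareOf, ebbOf_slice hW κ τ hs y]
  ring

end Summit.NavierStokesRegularity.NavierStokesRegularity.Theorems.ScenarioCensus.EulerianPincer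

end
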